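import Summits.Ventures.PercRepro.RankLevelSetBiIndepPerCircuitAll
import Summits.Ventures.PercRepro.RankLevelSetBiIndepContainMono

/-! # RankLevelSetBiIndepContainSkew — THE CONTAIN-X SKEWNESS (CX*) OF THE BI-INDEPENDENT PROFILE, AND THE COMPLETE
BRIDGE: (CX*) ON THE MINORS `(M / y) ∖ x` IMPLIES (★★) = `BiIndepPerElem` AT EVERY LEVEL (night-1 g28; dossier §40.9)

With `α^X_k = biContainCount N X k = #{Z ∈ D_k(N) : X ⊆ Z}`: **(CX*)** (`BiContainSkew N`, a `Prop`, NOT asserted):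
`α^X_k ≤ α^X_{#E − 1 − k}` for every `X ⊆ E` and `2k + 1 < #E` — the contain-`X` profile is skewed right about
`(#E − 1)/2`. For `X = ∅` it is `D_k ≤ D_{k+1}` (below the middle, by the complement symmetry), the consequence of the
named Lorentzian fact. Census (night-1 g28, own exact code): every matroid with ≤ 8 elements, every independent `X`,
every level (161,084 instances at `n = 8`): 0 failures. THE BRIDGE: for a circuit `C ∋ y` of `M`, `x ∈ C ∖ {y}`,
`N = (M / y) ∖ x` and `X = C ∖ {y, x}`, the per-circuit counts of `RankLevelSetBiIndepPerCircuitAll` are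
`ℓ_i(C) = α^X_{i−1}(N)` and `ρ_m(C) = α^X_{m−1}(N)` (`biContainCount_minor_eq`), and `#E(N) = i + m − 1`, so (CX*) for
`N` at `k = i − 1` is exactly `ℓ_i(C) ≤ ρ_m(C)`: **`perCircuitAll_of_biContainSkew : (∀ N ≤m M, BiContainSkew N) →`
`PerCircuitAll M`** and **`biIndepPerElem_of_biContainSkew : (∀ N ≤m M, BiContainSkew N) → BiIndepPerElem M`** — the
cell's conjecture (★★) at every level reduced, in the kernel, to a contain-set skewness of single matroids (no marked
element, no modular cut). Every declaration has a docstring; imports: the cell's own modules and Mathlib only.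
Axioms: standard. -/

namespace PercRepro

open Set Matroid

variable {α : Type} (M : Matroid α) [M.Finite]

omit [M.Finite] in
/-- **(CX*), the contain-`X` skewness** (a `Prop`, NOT asserted): `α^X_k ≤ α^X_{#E − 1 − k}` for every `X ⊆ E` and
every `k` with `2k + 1 < #E`. -/
def BiContainSkew : Prop :=
  ∀ X ⊆ M.E, ∀ k : ℕ, 2 * k + 1 < M.E.ncard → biContainCount M X k ≤ biContainCount M X (M.E.ncard - 1 - k)

omit [M.Finite] in
/-- The `ℓ_i(C)`-family at size `i + 1` is the contain-`(C ∖ {y, x})` family of `(M / y) ∖ x` at level `i`. -/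
lemma circuitLowCountAt_eq_biContainCount {y x : α} {C : Set α} (hC : M.IsCircuit C) (hyC : y ∈ C) (hxC : x ∈ C)
    (hxy : x ≠ y) (hy : M.Indep {y}) (i : ℕ) [M.Finite] :
    circuitLowCountAt M y C (i + 1) = biContainCount ((M ／ {y}) ＼ {x}) ((C \ {y}) \ {x}) i := by
  rw [biContainCount_minor_eq M hC hyC hxC hxy hy i]
  rfl

omit [M.Finite] in
/-- The `ρ_m(C)`-family at size `m + 1` is the contain-`(C ∖ {y, x})` family of `(M / y) ∖ x` at level `m`. -/
lemma circuitHighCountAt_eq_biContainCount {y x : α} {C : Set α} (hC : M.IsCircuit C) (hyC : y ∈ C) (hxC : x ∈ C)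
    (hxy : x ≠ y) (hy : M.Indep {y}) (m : ℕ) [M.Finite] :
    circuitHighCountAt M y C (m + 1) = biContainCount ((M ／ {y}) ＼ {x}) ((C \ {y}) \ {x}) m := by
  rw [biContainCount_minor_eq M hC hyC hxC hxy hy m]
  rfl

/-- If `y` is a loop, the per-circuit low families are empty. -/
lemma circuitLowCountAt_eq_zero_of_loop {y : α} (hy : ¬ M.Indep {y}) (C : Set α) (i : ℕ) :
    circuitLowCountAt M y C i = 0 := by
  unfold circuitLowCountAt
  rw [Set.ncard_eq_zero (M.ground_finite.finite_subsets.subset (fun P hP => hP.1.trans Set.sdiff_subset))]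
  ext P
  simp only [Set.mem_setOf_eq, Set.mem_empty_iff_false, iff_false, not_and]
  intro _ _ _ _ hind
  exact hy (hind.subset (Set.singleton_subset_iff.mpr (Set.mem_insert y _)))

/-- **(CX*) ON THE MINORS IMPLIES (PC) AT EVERY LEVEL**. -/
theorem perCircuitAll_of_biContainSkew (h : ∀ N : Matroid α, N ≤m M → BiContainSkew N) : PerCircuitAll M := by
  intro y hyE C hC hyC i m hi hn
  by_cases hy : M.Indep {y}
  · have hne : (C \ {y}).Nonempty := by
      by_contra hempty
      rw [Set.not_nonempty_iff_eq_empty, Set.sdiff_eq_empty] at hempty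
      exact hC.dep.not_indep (hy.subset hempty)
    obtain ⟨x, hxC, hxy'⟩ := hne
    have hxy : x ≠ y := fun h => hxy' (Set.mem_singleton_iff.mpr h)
    have hxE : x ∈ M.E := hC.subset_ground hxC
    have hxE' : x ∈ M.E \ {y} := ⟨hxE, fun h => hxy (Set.mem_singleton_iff.mp h)⟩
    have hNmin : (M ／ {y}) ＼ {x} ≤m M := ⟨{y}, {x}, rfl⟩
    have hNcard : ((M ／ {y}) ＼ {x}).E.ncard = i + m - 1 := by
      rw [minor_ground_eq', Set.ncard_sdiff_singleton_of_mem hxE', Set.ncard_sdiff_singleton_of_mem hyE, hn]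
      omega
    have hXE : (C \ {y}) \ {x} ⊆ ((M ／ {y}) ＼ {x}).E := by
      rw [minor_ground_eq']
      intro z hz
      exact ⟨⟨hC.subset_ground hz.1.1, hz.1.2⟩, hz.2⟩
    rcases i with _ | k
    · -- `i = 0`: no `0`-set contains the nonempty `C ∖ {y}`
      have hzero : circuitLowCountAt M y C 0 = 0 := by
        unfold circuitLowCountAt
        rw [Set.ncard_eq_zero (M.ground_finite.finite_subsets.subset (fun P hP => hP.1.trans Set.sdiff_subset))]
        ext P
        simp only [Set.mem_setOf_eq, Set.mem_empty_iff_false, iff_false, not_and]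
        intro hPE hP0 hCP _ _
        have hPfin : P.Finite := M.ground_finite.subset (hPE.trans Set.sdiff_subset)
        rw [Set.ncard_eq_zero hPfin] at hP0
        rw [hP0] at hCP
        exact hCP ⟨hxC, hxy'⟩
      rw [hzero]
      exact Nat.zero_le _
    · -- `i = k + 1`, `m = k' + 1`
      obtain ⟨k', rfl⟩ : ∃ k', m = k' + 1 := ⟨m - 1, by omega⟩
      have hstep := h _ hNmin _ hXE k (by rw [hNcard]; omega)
      rw [hNcard, show k + 1 + (k' + 1) - 1 - 1 - k = k' by omega] at hstep
      rw [circuitLowCountAt_eq_biContainCount M hC hyC hxC hxy hy k,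
        circuitHighCountAt_eq_biContainCount M hC hyC hxC hxy hy k']
      exact hstep
  · rw [circuitLowCountAt_eq_zero_of_loop M hy C i]
    exact Nat.zero_le _

/-- **(CX*) ON THE MINORS IMPLIES (★★) AT EVERY LEVEL**: `(∀ N ≤m M, BiContainSkew N) → BiIndepPerElem M`. -/
theorem biIndepPerElem_of_biContainSkew (h : ∀ N : Matroid α, N ≤m M → BiContainSkew N) : BiIndepPerElem M :=
  biIndepPerElem_of_perCircuitAll M (perCircuitAll_of_biContainSkew M h)

/-- **(CX*) for every finite matroid implies (★★) for every finite matroid** (the minors of a finite matroid are finite). -/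
theorem biIndepPerElem_of_biContainSkew_all (hall : ∀ (N : Matroid α) [N.Finite], BiContainSkew N) :
    BiIndepPerElem M :=
  biIndepPerElem_of_biContainSkew M (fun N hN => haveI : N.Finite := ⟨M.ground_finite.subset hN.subset⟩; hall N)

end PercRepro
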